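import Summits.QuantumFields.YangMills.Theorems.AlphaInputsT3ACv3HLiftClauseOfStart
import Summits.QuantumFields.YangMills.Theorems.AlphaInputsT3ACv3StartCertKnit
import HarnessLib

/-!
# `AlphaInputsT3ACv3HLiftClause` — MAP #3 M22, FINAL FORM (v3): **THE `hLift` CLAUSE FOR `16 ≤ L^k` WITH NO DISPLAYED ROW** — ★★★ `hLift_clause`: for one `(k, h, V)`, `k ≤ K`,
# `16 ≤ L^k`, `4L^k ≤ sitesPerDir 0`, `|n| = 2`, `0 < ε′ ≤ 1∕(10³⁴·L)` and a datum `V` with `dist1 V(∂Q) ≤ ε′` on `plaqsIn k Ω_{k+1}(h)`: some finest `U` has EXACT `k`-fold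
# `expMeanLogSU`-block averages `V` on `bondsIn k Ω_{k+1}(h)` and `dist1 U(∂q) ≤ 10²⁷·(ε′∕(L^k)²)` on `plaqsIn 0 Ω_{k+1}(h)` — the Newton half `hLift_clause_of_PD` (this seat) at LEAD
# ★w1 g2's START certificate of record ★★★`startT3_cert_omega` (all lattice binders and (S6) rows knitted in; its two numeral windows `ε′ ≤ 10⁻⁵`, `10²²·L·ε′ ≤ 1` lie inside
# `ε′ ≤ 1∕(10³⁴·L)`).  This is LITERALLY the `hBig` clause consumed by ★w2 g3's ✓ `hLift_window_of_clauses` (`εFL := 1∕(10³⁴·L)`, `Bbig := 10²⁷`; shape of record, ★★OWNER g26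
# ASSIGNMENTS 8 (d)) — lane `pub-balaban3d` ∕ cell `ym3-torus`, seat `ym-ust-19936-w4` (g3)

HONEST FRAMING.  Composition of landed theorems; `hLift` for ALL `k` is ★w2 g3's window knit (small `k` = LEAD's ✓`hLift_small`); the stub 2′χ `stub_laneRecordsV3Chi`, the crux `HistoryTailL`
and any gap are NOT claimed here; count-neutral helper toward R3 2′ (items 19936∕19935); registry untouched; nothing about d = 4, the continuum, or a mass gap; YM₃ on T³ is rung R3 of
the YM ladder, not the Clay problem.

References: T. Bałaban, Commun. Math. Phys. 102 (1985) 277–309 [Balaban1985Variational] (Thm 1 (8) p.279, (11)–(15) pp.279–280); CMP 98 (1985) 17–51 [Balaban1985Averaging]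
(Props. 4–5 pp.38–42).
-/

set_option autoImplicit false

noncomputable section

open scoped Matrix.Norms.L2Operator

namespace Summit.QuantumFields.YangMills.Theorems.TubeStart

open Literature.MathematicalPhysics.QuantumFieldTheory.Balaban1983to89
open T4Continuum BlockAveraging ExpMeanLog
open Literature.MathematicalPhysics.QuantumFieldTheory.Balaban1983to89.B10Eq38TorusDomains (plaqsIn)
open Literature.MathematicalPhysics.QuantumFieldTheory.Balaban1983to89.B10Eq42TorusConstraint (bondsIn)
open Literature.MathematicalPhysics.QuantumFieldTheory.Balaban1983to89.T3ContinuumYM3Torus (T3Family)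
open Summit.QuantumFields.Balaban3D.Carriers

variable (F : T3Family) (K : ℕ) (M₁ : ℕ) (Rcol : ℕ → ℕ) {n : Type*} [Fintype n] [DecidableEq n] [Nonempty n]

open Classical in
/-- **★★★ THE `hLift` CLAUSE FOR `16 ≤ L^k` (M22, FINAL FORM — no displayed row)**: `k ≤ K`, `16 ≤ L^k`, `4L^k ≤ sitesPerDir 0`, `|n| = 2`, `0 < ε′ ≤ 1∕(10³⁴·L)`,
`dist1 V(∂Q) ≤ ε′` on `plaqsIn k Ω_{k+1}(h)` ⟹ an exact `k`-fold lift `U` of `V` on `bondsIn k Ω_{k+1}(h)` with `dist1 U(∂q) ≤ 10²⁷·(ε′∕(L^k)²)` on `plaqsIn 0 Ω_{k+1}(h)` —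
`hLift_clause_of_PD` ∘ `startT3_cert_omega`. [cite: Balaban1985Variational, Thm 1 (8) p.279, (11)–(15) pp.279–280; Balaban1985Averaging, Props. 4–5 pp.38–42] -/
theorem hLift_clause (hn2 : Fintype.card n = 2) {k : ℕ} (hkK : k ≤ K) (hm : 16 ≤ (F.P K).L ^ k) (hN4 : 4 * (F.P K).L ^ k ≤ (F.P K).sitesPerDir 0)
    (h : Hist (F.P K) (k + 1)) (V : GaugeField (F.P K) k (Matrix.specialUnitaryGroup n ℂ)) {ε' : ℝ} (hε : 0 < ε') (hεFL : ε' ≤ 1 / (10 ^ 34 * (F.L : ℝ)))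
    (hV : ∀ Q, Q ∈ plaqsIn k (Omega M₁ Rcol (k + 1) h (k + 1)) → GaugeGroup.dist1 (GaugeField.plaqHol V Q) ≤ ε') :
    ∃ U : GaugeField (F.P K) 0 (Matrix.specialUnitaryGroup n ℂ),
      (∀ b : PBond (F.P K) k, b ∈ bondsIn k (Omega M₁ Rcol (k + 1) h (k + 1)) →
        Averaging.iter (fun i => (blockAvg (expMeanLogSU (n := n)) : Averaging (F.P K) i (Matrix.specialUnitaryGroup n ℂ))) k U b = V b) ∧
      ∀ q : Plaq (F.P K) 0, q ∈ plaqsIn 0 (Omega M₁ Rcol (k + 1) h (k + 1)) →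
        GaugeGroup.dist1 (GaugeField.plaqHol U q) ≤ 10 ^ 27 * (ε' / (((F.P K).L : ℝ) ^ k) ^ 2) := by
  have hPL : (F.P K).L = F.L := rfl
  have hL3 : 3 ≤ (F.P K).L := three_le_PL F K
  have hk1 : k + 1 ≤ (F.P K).m + (F.P K).K := by
    have h1 : 1 ≤ F.m := F.hm
    show k + 1 ≤ F.m + K
    omega
  have hεFL' : ε' ≤ 1 / (10 ^ 34 * ((F.P K).L : ℝ)) := by rw [hPL]; exact hεFL
  obtain ⟨hε5, hε4, -, -, hLE⟩ := window_eps (F.P K) hL3 hε hεFL'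
  have hεS : (10 : ℝ) ^ 22 * (F.L : ℝ) * ε' ≤ 1 := by
    rw [← hPL]
    have h0 : 0 ≤ ((F.P K).L : ℝ) * ε' := by positivity
    nlinarith
  have hδ₀0 : 0 ≤ startBd F K k ε' := startBd_nonneg F K k hε.le
  have hδ₀B : startBd F K k ε' ≤ 83559424 * ε' / (((F.P K).L ^ k : ℕ) : ℝ) ^ 2 := startBd_le F K k hm hε.le hε4
  obtain ⟨hP, hD⟩ := startT3_cert_omega F K k M₁ Rcol h V hk1 hm hN4 hn2 hε.le hε5 hV hεS
  exact hLift_clause_of_PD F K M₁ Rcol hn2 hkK hm hN4 h V hε hεFL _ hδ₀0 hδ₀B hP hD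

end Summit.QuantumFields.YangMills.Theorems.TubeStart

end
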